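import Literature.NumberTheory.LFunctions.Zhang2022.KnifeEdgeLenZDegreePsiOn

/-!
# Zhang (2022), rung F-S3 (Landau–Siegel programme, §D CHAIN #1 «toeplitz closure squad», crux K0 = stmt-Parity-20016
# `InClassSideTables`): the side-table slot RESTATED ON IN-CLASS PIECES (`InClassMeanPiece`), the sharp-cutoff witness that
# separates it from the typed slot `InClassMean`, and the route's whole `closes` chain re-threaded over the restated slot

Y. Zhang, *Discrete mean estimates and the Landau–Siegel zero*, arXiv:2211.02515v1 [Zhang2022LandauSiegel] — an
unrefereed manuscript under adjudication. **WHAT THIS IS NOT: not a claim about Theorems 1–2 of arXiv:2211.02515, about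
Landau–Siegel zeros, or about Parity. The programme SEARCHES and TYPES; no claim about Landau–Siegel zeros, Theorems 1–2 of
arXiv:2211.02515 or a repaired Margin232 until a kernel theorem says so. `InClassMeanPiece` is a bare `Prop` (a statement
SHAPE, asserted by no one); every `theorem` below is either elementary calculus about an explicit profile or an implication
between slot shapes and the tree's nodes.**

## Why (prover ls-knife-K0-p1 g0, memo `K0-MISSTATED.md` on stmt-Parity-20016)

The tree's side-table slot `KnifeEdge.InClassMean c′` (KnifeEdgeSlotCalculus, p461073) quantifies over
`Repair.KinkedProfile u u′` — continuous on `[0,1]`, right-differentiable inside, `u′ ∈ L²` — with NO condition `u 1 = 0`.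
So it contains the constant profile `u ≡ 1` (`kinkedProfile_const` below), whose profile polynomial
`profPoly χ x 1 (⌊P⌋+1) = Σ_{n ≤ ⌊P⌋} χψ(n)n^{−s}` is a SHARP CUTOFF at the wall `n = P` (an `O(1)` jump, a `k = 0` atom in
the cell's vocabulary), for which the slot asserts the main term `mainTermForm 1 0 · 𝔞𝔓 = 40π·𝔞𝔓`
(`mainTermForm_const_one`). By the cell's structural record (pub-zhang STRUCTURE.md §6: «the edge dominates unless the
jump vanishes as D → ∞; the admissible design space at main order is exactly the C⁰ class, jumps only at n = 1») and the
rulebook (theory M-RULEBOOK (D13′): «a k = 0 atom gives 𝓛^{+4.4}»), the (A)-world discrete mean of a sharply cut sum is of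
order `𝓛⁹·𝔓 ≫ 𝔞𝔓`, so the typed slot is, for every `c′`, EQUIVALENT to «(A) fails eventually» — summit-strength, not the
M-sized derivation debt the route booked. Every CONSUMER of the slot in the tree feeds it `KnifeEdge.InClassPiece` profiles
only (`gramEntryAsymp_psi_diag` via `hf.kinked`, hence the whole `closes` chain of route `ZDegreeToeplitzBand`;
`gramEntryAsymp_psiOn`; `discMean_profPoly_le_of_inClassMean` at `h•.kinked`). This file therefore types the slot the route
MEANT — `InClassMeanPiece c′`: the same asymptotic for `InClassPiece u u′` (kinked AND `u = u′ = 0` on `[1,∞)`, so no jump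
at the wall and `mainTermForm`'s endpoint terms `a₁ = u(1)` vanish, where `KnifeEdge.k0polar_self_eq_mainTermForm`,
p533892, identifies the constant with formula I) — and re-proves every consumer over it, so that the planner's restatement
of K0 to `∃ c₀, ∀ c′ ≥ c₀, InClassMeanPiece c′` keeps the route's deciding theorem verbatim
(`theorem1_of_gradedClosesPsi_pack_eventually_piece`).

## Contents

* Part 1 — `InClassMeanPiece` (shape); `inClassMeanPiece_of_inClassMean` (the typed slot implies it); the witness:
  `kinkedProfile_const` (constants are kinked profiles), `not_inClassPiece_const_one` (but `1` is not an in-class piece),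
  `mainTermForm_const_one` (`𝔅(1) = 40π`, the constant the typed slot asserts for the sharp cutoff).
* Part 2 — the ψ-graded chain over the restated slot: `gramEntryAsymp_psi_diag_piece`, `gramEntryAsymp_psi_piece`,
  `theorem1_of_gradedClosesPsi_piece`, `…_closed_piece`, `…_pack_closed_piece`, `…_pack_eventually_piece` (+ Theorem 2).
* Part 3 — the half-class chain over the restated slot: `gramEntryAsymp_psiOn_piece`,
  `notAEventually_of_gradedClosesPsiOn_piece`, `gradedClosesPsi_of_gradedClosesPsiOn_piece`,
  `theorem1_of_gradedClosesPsiOn_pack_eventually_piece`; and the upper-bound reading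
  `discMean_profPoly_le_of_inClassMeanPiece`.

No item of any route is restated here (D-0014: restating is the planner's); nothing is asserted about (A).

## References
* Y. Zhang, arXiv:2211.02515v1 (2022), §2 (2.16)–(2.17), p. 6; §7 Prop 7.1, (7.2); §8 (8.3), (8.5), (8.23).
  [cite: Zhang2022LandauSiegel, §2 (2.16), §7 Prop 7.1 (7.2), §8 (8.23)]
-/

noncomputable section

open Complex Real ComplexConjugate Set MeasureTheory intervalIntegral

namespace Literature.NumberTheory.LFunctions.Zhang2022

namespace KnifeEdge

open Repair Skeleton

/-! ### Part 1 — the restated slot and the sharp-cutoff witness -/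

section Slot

variable (c' : ℝ)

/-- **IN-CLASS SLOT ON IN-CLASS PIECES (shape, NOT asserted) — the repaired K0:** under (A), eventually in `D`, the discrete
mean of the polynomial of ONE in-class piece `u` (`InClassPiece u u′`: kinked on `[0,1]`, `u = u′ = 0` on `[1,∞)`, so NO jump
at the wall `n = P`) of length `P` is `𝔅(u)·𝔞𝔓 + o(𝔞𝔓)`, `𝔅 = mainTermForm` — Zhang's Prop 7.1 / (8.23) dictionary for a
single piece; the tree's `InClassMean c′` with its binder `Repair.KinkedProfile` narrowed to `KnifeEdge.InClassPiece`.
[cite: Zhang2022LandauSiegel, §7 Prop 7.1, §8 (8.23)] -/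
def InClassMeanPiece : Prop :=
  ∀ (u u' : ℝ → ℂ), InClassPiece u u' → ∀ ε : ℝ, 0 < ε → ForAllLarge fun D _ χ => AssumptionA D χ →
    |discMean c' χ (fun x t => profPoly χ x u (⌊bigP D⌋₊ + 1) t) - mainTermForm u u' * frakA χ * frakP D|
      ≤ ε * frakA χ * frakP D

variable {c'}

/-- The typed slot (all kinked profiles) implies the restated one (in-class pieces). [cite: Zhang2022LandauSiegel, §8 (8.23)] -/
theorem inClassMeanPiece_of_inClassMean (h : InClassMean c') : InClassMeanPiece c' :=
  fun u u' hu ε hε => h u u' hu.kinked ε hε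

/-- **Constants are kinked profiles** (`Repair.KinkedProfile` has no endpoint condition): `u ≡ a`, `u′ ≡ 0`. In particular the
sharp-cutoff design `u ≡ 1` is in the class the typed slot `InClassMean` quantifies over. [cite: Zhang2022LandauSiegel, §7 (7.2)] -/
theorem kinkedProfile_const (a : ℂ) : KinkedProfile (fun _ => a) (fun _ => 0) where
  cont := continuousOn_const
  hasDeriv := fun x _ => (hasDerivAt_const x a).hasDerivWithinAt
  memLp := by
    have : (fun _ : ℝ => (0 : ℂ)) = 0 := rfl
    rw [this]
    exact MemLp.zero

/-- … but the constant `1` is NOT an in-class piece (`InClassPiece.vanish` forces `u 1 = 0`): the restated slot does not see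
the sharp cutoff. [cite: Zhang2022LandauSiegel, §7 (7.2)] -/
theorem not_inClassPiece_const_one (u' : ℝ → ℂ) : ¬ InClassPiece (fun _ : ℝ => (1 : ℂ)) u' := fun h =>
  one_ne_zero (h.vanish 1 le_rfl)

/-- **`𝔅(1) = 40π`:** the main-term constant the typed slot asserts for the sharply cut sum `Σ_{n≤P} χψ(n)n^{−s}`
(`(4.1)` with `g ≡ 1`, `g′ ≡ 0`, `S(y) = y`: `88π − 24π·Re(1·(1+1)) = 40π`; crit-1's desk value, STATUS 11:53:22Z).
[cite: Zhang2022LandauSiegel, §8 (8.23)] -/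
theorem mainTermForm_const_one : mainTermForm (fun _ : ℝ => (1 : ℂ)) (fun _ => 0) = 40 * π := by
  have hS : ∀ y : ℝ, (∫ t in (0:ℝ)..y, (fun _ : ℝ => (1 : ℂ)) t) = (y : ℂ) := by
    intro y; simp
  have h1 : (∫ x in (0:ℝ)..1, ‖((fun _ : ℝ => (0 : ℂ)) x)‖ ^ 2) = 0 := by simp
  have h2 : (∫ x in (0:ℝ)..1, (fun _ : ℝ => (0 : ℂ)) x * conj ((fun _ : ℝ => (1 : ℂ)) x)) = 0 := by simp
  have h3 : (∫ x in (0:ℝ)..1, ‖((fun _ : ℝ => (1 : ℂ)) x)‖ ^ 2) = 1 := by simp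
  have h4 : (∫ x in (0:ℝ)..1, (fun _ : ℝ => (1 : ℂ)) x * conj ((x : ℝ) : ℂ)) = 1 / 2 := by
    simp only [one_mul, Complex.conj_ofReal]
    rw [intervalIntegral.integral_ofReal, integral_id]
    push_cast; ring
  unfold mainTermForm mainTermFormJet primitiveJet
  simp only [hS]
  rw [h1, h2, h3, h4]
  simp
  ring

end Slot

/-! ### Part 2 — the ψ-graded endgame chain of route `ZDegreeToeplitzBand` over the restated slot -/

section PsiChain

variable {c' : ℝ} {X₁ Y₁ X₂ : PairFunctional} {f f' g₁ g₁' g₂ g₂' : ℝ → ℂ}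

/-- a real discrete mean within `δ𝔞𝔓` of its constant, read as a complex entry estimate. [folklore] -/
private theorem entry_of_real_piece {x m a p δ : ℝ} (h : |x - m * a * p| ≤ δ * a * p) :
    ‖((x : ℝ) : ℂ) - (m : ℂ) * a * p‖ ≤ δ * a * p := by
  rw [← Complex.ofReal_mul, ← Complex.ofReal_mul, ← Complex.ofReal_sub, Complex.norm_real, Real.norm_eq_abs]
  exact h

/-- **Diagonal slots from the restated side table** (`gramEntryAsymp_psi_diag` with `InClassMeanPiece` in place of
`InClassMean` — the proof is the tree's, the in-class hypotheses are now used in full rather than through `.kinked`).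
[cite: Zhang2022LandauSiegel, §7 Prop 7.1, §8 (8.2)–(8.3)] -/
theorem gramEntryAsymp_psi_diag_piece (h0 : InClassMeanPiece c') (h22 : Prop22i) (hf : InClassPiece f f')
    (hg₁ : InClassPiece g₁ g₁') (hg₂ : InClassPiece g₂ g₂') (k : Fin 3) :
    GramEntryAsymp c' (psiPieceTable f g₁ g₂ k) (psiPieceTable f g₁ g₂ k)
      (gradedMainMatrix X₁ Y₁ X₂ f f' g₁ g₁' g₂ g₂' k k) := by
  have hsel : ∃ (g g' : ℝ → ℂ), InClassPiece g g' ∧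
      gradedMainMatrix X₁ Y₁ X₂ f f' g₁ g₁' g₂ g₂' k k = (mainTermForm g g' : ℂ) ∧
      ∀ (D : ℕ) [NeZero D] (χ : DirichletCharacter ℂ D),
        (basePiece χ f g₁ g₂ k = fun x t => profPoly χ x g (⌊bigP D⌋₊ + 1) t) ∨
        (basePiece χ f g₁ g₂ k = fun x t => conj (profPoly χ x g (⌊bigP D⌋₊ + 1) t)) := by
    fin_cases k
    · exact ⟨f, f', hf, rfl, fun D _ χ => Or.inl rfl⟩
    · exact ⟨g₁, g₁', hg₁, rfl, fun D _ χ => Or.inr rfl⟩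
    · exact ⟨g₂, g₂', hg₂, rfl, fun D _ χ => Or.inr rfl⟩
  obtain ⟨g, g', hg, hM, hbase⟩ := hsel
  intro ε hε
  obtain ⟨D₁, hD₁⟩ := (h0 g g' hg ε hε).and h22
  refine ⟨max D₁ 3, fun D _ χ hD hq hp hA => ?_⟩
  have hD3 : 3 ≤ D := le_trans (le_max_right _ _) hD
  obtain ⟨hmean, h22'⟩ := hD₁ D χ (le_trans (le_max_left _ _) hD) hq hp
  have hW := norm_Zpsi_eq_one_of (χ := χ) hD3 h22'
  have hdiag : discPolar c' χ (psiPieceTable f g₁ g₂ k D χ) (psiPieceTable f g₁ g₂ k D χ) =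
      ((discMean c' χ (fun x t => profPoly χ x g (⌊bigP D⌋₊ + 1) t) : ℝ) : ℂ) := by
    rw [discPolar_self]
    simp only [psiPieceTable, psiGradedPiece, discMean_zTwistW (W := fun x s => GammaFactor.Zfac x.ψ s) hW]
    rcases hbase D χ with hb | hb
    · rw [hb]
    · rw [hb, discMean_conj]
  rw [hdiag, hM]
  exact entry_of_real_piece (hmean hA)

/-- **All nine Gram-entry slots of the ψ-graded design** from the restated side table, the three ψ-graded tables and
Prop. 2.2 (i) (`gramEntryAsymp_psi` re-threaded). [cite: Zhang2022LandauSiegel, §2 (2.16)–(2.17)] -/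
theorem gramEntryAsymp_psi_piece (h0 : InClassMeanPiece c') (h1 : CrossTablePsi c' 1 X₁) (h21 : DualCrossTablePsi c' 1 Y₁)
    (h2 : TauTwoTablePsi c' X₂) (h22 : Prop22i) (hf : InClassPiece f f') (hg₁ : InClassPiece g₁ g₁')
    (hg₂ : InClassPiece g₂ g₂') :
    ∀ a b, GramEntryAsymp c' (psiPieceTable f g₁ g₂ a) (psiPieceTable f g₁ g₂ b)
      (gradedMainMatrix X₁ Y₁ X₂ f f' g₁ g₁' g₂ g₂' a b) := by
  obtain ⟨e10, e20, e21⟩ := gramEntryAsymp_psi_offdiag h1 h21 h2 h22 hf hg₁ hg₂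
  refine gramEntryAsymp_of_lower (gradedMainMatrix_conj_symm X₁ Y₁ X₂ f f' g₁ g₁' g₂ g₂') fun a b hba => ?_
  fin_cases a <;> fin_cases b
  · exact gramEntryAsymp_psi_diag_piece h0 h22 hf hg₁ hg₂ 0
  · exact absurd hba (by decide)
  · exact absurd hba (by decide)
  · exact e10
  · exact gramEntryAsymp_psi_diag_piece h0 h22 hf hg₁ hg₂ 1
  · exact absurd hba (by decide)
  · exact e20
  · exact e21
  · exact gramEntryAsymp_psi_diag_piece h0 h22 hf hg₁ hg₂ 2

/-- **The ψ-graded endgame over the restated side table:** `InClassMeanPiece` ∧ the ψ-graded degree-1 tables ∧ the degree-2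
table ∧ a non-PSD in-class design ∧ Prop. 2.2 (i) ∧ Lemma 2.3 ⇒ Theorem 1 (`theorem1_of_gradedClosesPsi` re-threaded).
[cite: Zhang2022LandauSiegel, §1 Theorem 1, §2 p. 6, (2.16)] -/
theorem theorem1_of_gradedClosesPsi_piece (h0 : InClassMeanPiece c') (h1 : CrossTablePsi c' 1 X₁)
    (h21 : DualCrossTablePsi c' 1 Y₁) (h2 : TauTwoTablePsi c' X₂) (hC : GradedCloses X₁ Y₁ X₂) (h22 : Prop22i)
    (h23 : Lemma23 c') : Theorem1 := by
  obtain ⟨f, f', g₁, g₁', g₂, g₂', s, hf, hg₁, hg₂, hneg⟩ := hC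
  exact theorem1_of_gramSlots (gramEntryAsymp_psi_piece h0 h1 h21 h2 h22 hf hg₁ hg₂) hneg h22 h23

/-- … and Theorem 2. [cite: Zhang2022LandauSiegel, §1 Theorem 2] -/
theorem theorem2_of_gradedClosesPsi_piece (h0 : InClassMeanPiece c') (h1 : CrossTablePsi c' 1 X₁)
    (h21 : DualCrossTablePsi c' 1 Y₁) (h2 : TauTwoTablePsi c' X₂) (hC : GradedCloses X₁ Y₁ X₂) (h22 : Prop22i)
    (h23 : Lemma23 c') : Theorem2 :=
  Skeleton.theorem2_of_theorem1 (theorem1_of_gradedClosesPsi_piece h0 h1 h21 h2 hC h22 h23)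

/-- **CLOSED (N12 shape) over the restated side table:** for every sufficiently large `c′`, `InClassMeanPiece c′`, the three
ψ-graded tables and a non-PSD design give Theorem 1 — Prop. 2.2 (i) / Lemma 2.3 discharged by the tree
(`prop22i_holds`, `lemma23_eventually`). [cite: Zhang2022LandauSiegel, §1 Theorem 1, §2 p. 6] -/
theorem theorem1_of_gradedClosesPsi_closed_piece :
    ∃ c₀ : ℝ, 0 ≤ c₀ ∧ ∀ c' : ℝ, c₀ ≤ c' → ∀ X₁ Y₁ X₂ : PairFunctional,
      InClassMeanPiece c' → CrossTablePsi c' 1 X₁ → DualCrossTablePsi c' 1 Y₁ → TauTwoTablePsi c' X₂ →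
      GradedCloses X₁ Y₁ X₂ → Theorem1 := by
  obtain ⟨c₀, h0, h⟩ := lemma23_eventually
  exact ⟨c₀, h0, fun c' hc' _ _ _ h0' h1 h21 h2 hC =>
    theorem1_of_gradedClosesPsi_piece h0' h1 h21 h2 hC prop22i_holds (h c' hc')⟩

/-- **The packaged crux over the restated side table, closed:** for every sufficiently large `c′`,
`InClassMeanPiece c′ → GradedClosesPsi c′ → Theorem1` (`theorem1_of_gradedClosesPsi_pack_closed` re-threaded).
[cite: Zhang2022LandauSiegel, §1 Theorem 1] -/
theorem theorem1_of_gradedClosesPsi_pack_closed_piece :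
    ∃ c₀ : ℝ, 0 ≤ c₀ ∧ ∀ c' : ℝ, c₀ ≤ c' → InClassMeanPiece c' → GradedClosesPsi c' → Theorem1 := by
  obtain ⟨c₀, hc0, hcl⟩ := theorem1_of_gradedClosesPsi_closed_piece
  refine ⟨c₀, hc0, fun c' hc' h0 h => ?_⟩
  obtain ⟨X₁, Y₁, X₂, h1, h21, h2, hC⟩ := h
  exact hcl c' hc' X₁ Y₁ X₂ h0 h1 h21 h2 hC

/-- **THE ROUTE'S GLUE OVER THE RESTATED K0:** the restated side tables for all large `c′` ∧ the packaged crux for all large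
`c′` ⇒ Theorem 1 (`theorem1_of_gradedClosesPsi_pack_eventually` re-threaded; this is what the deciding theorem `closes` of
`Theses/ZDegreeToeplitzBand.lean` calls, so the restatement `InClassSideTables := ∃ c₀, ∀ c′ ≥ c₀, InClassMeanPiece c′`
keeps `closes` verbatim up to this name). [cite: Zhang2022LandauSiegel, §1 Theorem 1, §2 p. 6] -/
theorem theorem1_of_gradedClosesPsi_pack_eventually_piece (h0 : ∃ c₁ : ℝ, ∀ c' : ℝ, c₁ ≤ c' → InClassMeanPiece c')
    (h : ∃ c₂ : ℝ, ∀ c' : ℝ, c₂ ≤ c' → GradedClosesPsi c') : Theorem1 := by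
  obtain ⟨c₀, -, hcl⟩ := theorem1_of_gradedClosesPsi_pack_closed_piece
  obtain ⟨c₁, h₁⟩ := h0
  obtain ⟨c₂, h₂⟩ := h
  exact hcl (max c₀ (max c₁ c₂)) (le_max_left _ _)
    (h₁ _ (le_trans (le_max_left _ _) (le_max_right _ _)))
    (h₂ _ (le_trans (le_max_right _ _) (le_max_right _ _)))

/-- … and Theorem 2. [cite: Zhang2022LandauSiegel, §1 Theorem 2] -/
theorem theorem2_of_gradedClosesPsi_pack_eventually_piece (h0 : ∃ c₁ : ℝ, ∀ c' : ℝ, c₁ ≤ c' → InClassMeanPiece c')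
    (h : ∃ c₂ : ℝ, ∀ c' : ℝ, c₂ ≤ c' → GradedClosesPsi c') : Theorem2 :=
  Skeleton.theorem2_of_theorem1 (theorem1_of_gradedClosesPsi_pack_eventually_piece h0 h)

/-- The typed K0 (eventually-in-`c′`) implies the restated one — so nothing already proved over `InClassMean` is lost.
[cite: Zhang2022LandauSiegel, §8 (8.23)] -/
theorem inClassMeanPiece_eventually_of_inClassMean (h0 : ∃ c₁ : ℝ, ∀ c' : ℝ, c₁ ≤ c' → InClassMean c') :
    ∃ c₁ : ℝ, ∀ c' : ℝ, c₁ ≤ c' → InClassMeanPiece c' := by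
  obtain ⟨c₁, h₁⟩ := h0
  exact ⟨c₁, fun c' hc' => inClassMeanPiece_of_inClassMean (h₁ c' hc')⟩

end PsiChain

/-! ### Part 3 — the half-class chain (`KnifeEdgeLenZDegreePsiOn`, p521869) and the upper-bound reading over the restated slot -/

section PsiOnChain

variable {c' : ℝ} {𝒞 : PairClass} {X₁ Y₁ X₂ : PairFunctional} {f f' g₁ g₁' g₂ g₂' : ℝ → ℂ}

/-- **All nine Gram-entry slots at a `𝒞`-design from tables ON `𝒞` and the restated side table** (`gramEntryAsymp_psiOn`
re-threaded). [cite: Zhang2022LandauSiegel, §2 (2.16) (2.17), §8 (8.5)] -/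
theorem gramEntryAsymp_psiOn_piece (h0 : InClassMeanPiece c') (h1 : CrossTablePsiOn c' 𝒞 1 X₁)
    (h21 : DualCrossTablePsiOn c' 𝒞 1 Y₁) (h2 : CrossTablePsiOn c' 𝒞 2 X₂) (h22 : Prop22i) (hf : InClassPiece f f')
    (hg₁ : InClassPiece g₁ g₁') (hg₂ : InClassPiece g₂ g₂') (c01 : 𝒞 f f' g₁ g₁') (c02 : 𝒞 f f' g₂ g₂')
    (c12 : 𝒞 g₁ g₁' g₂ g₂') :
    ∀ a b, GramEntryAsymp c' (psiPieceTable f g₁ g₂ a) (psiPieceTable f g₁ g₂ b)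
      (gradedMainMatrix X₁ Y₁ X₂ f f' g₁ g₁' g₂ g₂' a b) := by
  obtain ⟨e10, e20, e21⟩ := gramEntryAsymp_psiOn_offdiag h1 h21 h2 h22 hf hg₁ hg₂ c01 c02 c12
  refine gramEntryAsymp_of_lower (gradedMainMatrix_conj_symm X₁ Y₁ X₂ f f' g₁ g₁' g₂ g₂') fun a b hba => ?_
  fin_cases a <;> fin_cases b
  · exact gramEntryAsymp_psi_diag_piece h0 h22 hf hg₁ hg₂ 0
  · exact absurd hba (by decide)
  · exact absurd hba (by decide)
  · exact e10
  · exact gramEntryAsymp_psi_diag_piece h0 h22 hf hg₁ hg₂ 1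
  · exact absurd hba (by decide)
  · exact e20
  · exact e21
  · exact gramEntryAsymp_psi_diag_piece h0 h22 hf hg₁ hg₂ 2

/-- **Endgame ON a class over the restated side table:** `InClassMeanPiece c′` ∧ Prop. 2.2 (i) ∧ Lemma 2.3 ∧ the package
ON `𝒞` ⇒ (A) fails for every real primitive character to every large modulus. [cite: Zhang2022LandauSiegel, §2 p. 6, (2.16)] -/
theorem notAEventually_of_gradedClosesPsiOn_piece (h0 : InClassMeanPiece c') (h22 : Prop22i) (h23 : Lemma23 c')
    (hG : GradedClosesPsiOn c' 𝒞) : ForAllLarge fun D _ χ => ¬ AssumptionA D χ := by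
  obtain ⟨X₁, Y₁, X₂, h1, h21, h2, hC⟩ := hG
  obtain ⟨f, f', g₁, g₁', g₂, g₂', s, hf, hg₁, hg₂, c01, c02, c12, hneg⟩ := hC
  exact eventually_not_assumptionA_of_gramSlots
    (gramEntryAsymp_psiOn_piece h0 h1 h21 h2 h22 hf hg₁ hg₂ c01 c02 c12) hneg h22 h23

/-- … hence the FULL package `GradedClosesPsi c′`. [cite: Zhang2022LandauSiegel, §2 p. 6, (2.16)] -/
theorem gradedClosesPsi_of_gradedClosesPsiOn_piece (h0 : InClassMeanPiece c') (h22 : Prop22i) (h23 : Lemma23 c')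
    (hG : GradedClosesPsiOn c' 𝒞) : GradedClosesPsi c' :=
  gradedClosesPsi_of_notAEventually (notAEventually_of_gradedClosesPsiOn_piece h0 h22 h23 hG) c'

/-- **Closed eventually-in-`c′` form over the restated side table:** `InClassMeanPiece` for all large `c′` ∧ the package ON
`𝒞` for all large `c′` ⇒ Theorem 1 (`theorem1_of_gradedClosesPsiOn_pack_eventually` re-threaded).
[cite: Zhang2022LandauSiegel, §1 Theorem 1, §2 p. 6] -/
theorem theorem1_of_gradedClosesPsiOn_pack_eventually_piece
    (h0 : ∃ c₁ : ℝ, ∀ c' : ℝ, c₁ ≤ c' → InClassMeanPiece c')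
    (h : ∃ c₂ : ℝ, ∀ c' : ℝ, c₂ ≤ c' → GradedClosesPsiOn c' 𝒞) : Theorem1 := by
  obtain ⟨c₀, -, h23⟩ := lemma23_eventually
  obtain ⟨c₁, h₁⟩ := h0
  obtain ⟨c₂, h₂⟩ := h
  refine theorem1_of_gradedClosesPsi_pack_eventually_piece ⟨c₁, h₁⟩ ⟨max c₀ (max c₁ c₂), fun c' hc' => ?_⟩
  have hc0 : c₀ ≤ c' := le_trans (le_max_left _ _) hc'
  have hc1 : c₁ ≤ c' := le_trans (le_trans (le_max_left _ _) (le_max_right _ _)) hc'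
  have hc2 : c₂ ≤ c' := le_trans (le_trans (le_max_right _ _) (le_max_right _ _)) hc'
  exact gradedClosesPsi_of_gradedClosesPsiOn_piece (h₁ c' hc1) prop22i_holds (h23 c' hc0) (h₂ c' hc2)

/-- **The restated K0 as an upper bound** (`discMean_profPoly_le_of_inClassMean` re-threaded): for an in-class piece `u` and
`η > 0`, eventually under (A), `Ξ(H_u) ≤ (𝔅(u) + η)·𝔞𝔓`. [cite: Zhang2022LandauSiegel, §7 Prop 7.1, §8 (8.23)] -/
theorem discMean_profPoly_le_of_inClassMeanPiece (hK0 : InClassMeanPiece c') {u u' : ℝ → ℂ} (hu : InClassPiece u u')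
    {η : ℝ} (hη : 0 < η) :
    ForAllLarge fun D _ χ => AssumptionA D χ →
      discMean c' χ (fun x t => profPoly χ x u (⌊bigP D⌋₊ + 1) t) ≤ (mainTermForm u u' + η) * (frakA χ * frakP D) := by
  refine (hK0 u u' hu η hη).mono ?_
  intro D _ χ _ _ h hA
  have h1 := (abs_le.1 (h hA)).2
  calc discMean c' χ (fun x t => profPoly χ x u (⌊bigP D⌋₊ + 1) t)
      ≤ mainTermForm u u' * frakA χ * frakP D + η * frakA χ * frakP D := by linarith
    _ = (mainTermForm u u' + η) * (frakA χ * frakP D) := by ring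

/-- **The restated K0 as a two-sided bound in the units the refuters use:** for an in-class piece `u` and `η > 0`, eventually
under (A), `(𝔅(u) − η)·𝔞𝔓 ≤ Ξ(H_u) ≤ (𝔅(u) + η)·𝔞𝔓`. [cite: Zhang2022LandauSiegel, §7 Prop 7.1, §8 (8.23)] -/
theorem discMean_profPoly_bounds_of_inClassMeanPiece (hK0 : InClassMeanPiece c') {u u' : ℝ → ℂ}
    (hu : InClassPiece u u') {η : ℝ} (hη : 0 < η) :
    ForAllLarge fun D _ χ => AssumptionA D χ →
      (mainTermForm u u' - η) * (frakA χ * frakP D) ≤ discMean c' χ (fun x t => profPoly χ x u (⌊bigP D⌋₊ + 1) t) ∧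
      discMean c' χ (fun x t => profPoly χ x u (⌊bigP D⌋₊ + 1) t) ≤ (mainTermForm u u' + η) * (frakA χ * frakP D) := by
  refine (hK0 u u' hu η hη).mono ?_
  intro D _ χ _ _ h hA
  obtain ⟨h1, h2⟩ := abs_le.1 (h hA)
  constructor
  · calc (mainTermForm u u' - η) * (frakA χ * frakP D)
        = mainTermForm u u' * frakA χ * frakP D - η * frakA χ * frakP D := by ring
      _ ≤ discMean c' χ (fun x t => profPoly χ x u (⌊bigP D⌋₊ + 1) t) := by linarith
  · calc discMean c' χ (fun x t => profPoly χ x u (⌊bigP D⌋₊ + 1) t)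
        ≤ mainTermForm u u' * frakA χ * frakP D + η * frakA χ * frakP D := by linarith
      _ = (mainTermForm u u' + η) * (frakA χ * frakP D) := by ring

end PsiOnChain

end KnifeEdge

end Literature.NumberTheory.LFunctions.Zhang2022

end
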